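import Mathlib
import Summits.Ventures.PercRepro2.HCov
import Summits.Ventures.PercRepro2.RECMReduction
import Summits.Ventures.PercRepro2.A3Reduction
import Summits.Ventures.PercRepro2.PocketSign
import Summits.Ventures.PercRepro2.SepTwoGcZero
import Summits.Ventures.PercRepro2.SepThreeGcZero
import Summits.Ventures.PercRepro2.GcSkelRules
import Summits.Ventures.PercRepro2.GcSkelReduction
import Summits.Ventures.PercRepro2.GcSkelReductionS
import Summits.Ventures.PercRepro2.GcSkelReductionC
import Summits.Ventures.PercRepro2.HubClassesAll

/-!
# The weighted residual: the cores minus the proved classes (blind cell PercRepro2, typer-1 g52)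

On top of the cut-vertex-reduced class `WReducedC` (`GcSkelReductionC.lean`) the cell's class
THEOREMS that are not cut-vertex conditions remove further instances outright:

* class R — every edge at a root joins two marks — `Hub.HCov_of_classR` (`HubAll.HCovR_all_holds`);
* class R₃ — every edge at `a₃` joins two marks — `Hub3.HCov_of_classR3` (`HubAll.HCovR3_all_holds`);
* root-only pockets — `{a₁, a₂}` separates `a₃` from `{o, b}` — `PocketConn.HCov_pocket` (night-1);
* the (SEP-2) zero — `b` not reached from `o` in `G − {a₁, a₂}` — `SepTwoGcZero.Gc_eq_zero_of_sepPair`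
  (typer-1 g49);
* the (SEP-3) zeros — `{a₁, a₃}` (or `{a₂, a₃}`) cuts `o` off from the other root and from `b` —
  `SepThreeGcZero.Gc_eq_zero_of_sepThree` / `'` (typer-1 g49).

**`WReducedR`** := `WReducedC` ∧ none of these: a root and `a₃` each have an unmarked neighbour,
`a₃` lies in no root-only pocket, `b` is reached from `o` avoiding the roots, and `{a₁, a₃}` /
`{a₂, a₃}` cut `o` off from neither the other root nor `b`. **`HCov_all_iff_HCovWRedR_all`**: (HCOV)
for every finite weighted graph ⟺ (HCOV) on `WReducedR`. No induction: every clause is a theorem.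
-/

namespace Summit.Ventures.PercRepro2

open CovForm RECM SepPair

namespace WRed

section ClassR

variable {V : Type*} {E : Type*} [Fintype E] [DecidableEq E] [DecidableEq V]

/-- **The weighted residual class**: the cores (`WReducedC`) with the proved non-cut classes
removed — not class R, not class R₃, no root-only pocket around `a₃`, `b` reached from `o` in
`G − {a₁, a₂}`, and neither `{a₁, a₃}` nor `{a₂, a₃}` cuts `o` off from the other root and `b`. -/
structure WReducedR (ends : E → Sym2 V) (o a₁ a₂ a₃ b : V) : Prop
    extends WReducedC ends o a₁ a₂ a₃ b where
  /-- not class R: some root edge reaches an unmarked vertex -/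
  notR : ¬ RootsToMarks ends o a₁ a₂ a₃ b
  /-- not class R₃: some edge at `a₃` reaches an unmarked vertex -/
  notR3 : ¬ A3RECM.A3ToMarks ends o a₁ a₂ a₃ b
  /-- no root-only pocket contains `a₃` without `o`, `b` -/
  noPocket : ∀ P : Finset V, PocketConn.IsPocket ends (↑P : Set V) a₁ a₂ → a₃ ∈ P → a₁ ∉ P →
    a₂ ∉ P → o ∉ P → b ∈ P
  /-- `b` is reached from `o` in `G − {a₁, a₂}` -/
  sep2 : b ∈ cluster ends (sepConfig ends {a₁, a₂}) o
  /-- `{a₁, a₃}` does not cut `o` off from both `a₂` and `b` -/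
  sep3 : a₂ ∉ cluster ends (sepConfig ends {a₁, a₃}) o ∪ {a₁, a₃} →
    b ∈ cluster ends (sepConfig ends {a₁, a₃}) o
  /-- `{a₂, a₃}` does not cut `o` off from both `a₁` and `b` -/
  sep3' : a₁ ∉ cluster ends (sepConfig ends {a₂, a₃}) o ∪ {a₂, a₃} →
    b ∈ cluster ends (sepConfig ends {a₂, a₃}) o

end ClassR

section Closure

variable (R : Type*) [Field R] [LinearOrder R] [IsStrictOrderedRing R]

/-- **(HCOV) on the weighted residual class**. -/
def HCovWRedR_all : Prop :=
  ∀ (V E : Type) [Fintype V] [DecidableEq V] [Fintype E] [DecidableEq E]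
    (ends : E → Sym2 V) (p : E → R), IsProbVec p →
    ∀ o a₁ a₂ a₃ b : V, a₁ ≠ a₂ → a₁ ≠ a₃ → a₂ ≠ a₃ → o ≠ a₁ → o ≠ a₂ → o ≠ a₃ → o ≠ b →
      b ≠ a₁ → b ≠ a₂ → b ≠ a₃ → WReducedR ends o a₁ a₂ a₃ b → HCov p ends o a₁ a₂ a₃ b

end Closure

section Main

variable {R : Type*} [Field R] [LinearOrder R] [IsStrictOrderedRing R]

/-- (HCOV) on the cores follows from (HCOV) on the residual: every removed class is a theorem. -/
theorem HCovWRedC_all_of_HCovWRedR_all (hB : HCovWRedR_all R) : HCovWRedC_all R := by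
  intro V E _ _ _ _ ends p hp o a₁ a₂ a₃ b h12 h13 h23 ho1 ho2 ho3 hob hb1 hb2 hb3 hred
  by_cases hR : RootsToMarks ends o a₁ a₂ a₃ b
  · exact HubAll.HCovR_all_holds V E ends p hp o a₁ a₂ a₃ b h12 h13 h23 ho1 ho2 ho3 hob hb1 hb2
      hb3 hR
  by_cases hR3 : A3RECM.A3ToMarks ends o a₁ a₂ a₃ b
  · exact HubAll.HCovR3_all_holds V E ends p hp o a₁ a₂ a₃ b h12 h13 h23 ho1 ho2 ho3 hob hb1 hb2
      hb3 hR3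
  by_cases hP : ∃ P : Finset V, PocketConn.IsPocket ends (↑P : Set V) a₁ a₂ ∧ a₃ ∈ P ∧ a₁ ∉ P ∧
      a₂ ∉ P ∧ o ∉ P ∧ b ∉ P
  · obtain ⟨P, hPk, h3, h1, h2, ho, hb⟩ := hP
    exact PocketConn.HCov_pocket p hp hPk h12 h1 h2 ho hb h3
  by_cases hs2 : b ∈ cluster ends (sepConfig ends {a₁, a₂}) o
  swap
  · unfold HCov
    rw [SepTwoGcZero.Gc_eq_zero_of_sepPair hp ends a₃ b (by simp [ho1, ho2]) hs2]
  by_cases hs3 : a₂ ∉ cluster ends (sepConfig ends {a₁, a₃}) o ∪ {a₁, a₃} ∧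
      b ∉ cluster ends (sepConfig ends {a₁, a₃}) o
  · unfold HCov
    rw [SepThreeGcZero.Gc_eq_zero_of_sepThree hp ends (by simp [ho1, ho3]) hs3.1 hs3.2]
  by_cases hs3' : a₁ ∉ cluster ends (sepConfig ends {a₂, a₃}) o ∪ {a₂, a₃} ∧
      b ∉ cluster ends (sepConfig ends {a₂, a₃}) o
  · unfold HCov
    rw [SepThreeGcZero.Gc_eq_zero_of_sepThree' hp ends (by simp [ho2, ho3]) hs3'.1 hs3'.2]
  push Not at hP hs3 hs3'
  exact hB V E ends p hp o a₁ a₂ a₃ b h12 h13 h23 ho1 ho2 ho3 hob hb1 hb2 hb3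
    ⟨hred, hR, hR3, hP, hs2, hs3, hs3'⟩

/-- **THE WEIGHTED RESIDUAL THEOREM**: (HCOV) for every finite weighted graph with five distinct
marks follows from (HCOV) on the residual class — the cores minus the proved classes. -/
theorem HCov_all_of_HCovWRedR_all (hB : HCovWRedR_all R) : HCov_all R :=
  HCov_all_of_HCovWRedC_all (HCovWRedC_all_of_HCovWRedR_all hB)

/-- The residual is a faithful reduction: `HCov_all ↔ HCovWRedR_all`. -/
theorem HCov_all_iff_HCovWRedR_all : HCov_all R ↔ HCovWRedR_all R :=
  ⟨fun h V E _ _ _ _ ends p hp o a₁ a₂ a₃ b h12 h13 h23 ho1 ho2 ho3 hob hb1 hb2 hb3 _ =>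
    h V E ends p hp o a₁ a₂ a₃ b h12 h13 h23 ho1 ho2 ho3 hob hb1 hb2 hb3,
   HCov_all_of_HCovWRedR_all⟩

end Main

end WRed

end Summit.Ventures.PercRepro2
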